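import Mathlib

/-!
# Census evidence for crux `VanishingNoiseTransfer.NoiseLocality` (stmt-AtomisticToContinuum-11975):
# the logical position of the stubs of line `polya-noise-monotone` (kernel-checked tables)

Abstract resistivity tables `r N ε` (`r N 0` = deterministic chain of length `N`, `r N ε` = with flips at
rate `ε`).  Shapes (all in the normal form of the crux for zero-free tables, Disproof §3
`localityShape_iff_resistivity`):

* `UniformShape r`  — the crux: ONE modulus `w → 0` at `0⁺` with `|r N ε − r N 0| ≤ w ε` for all `N`, `ε ∈ (0,1]`.
* `S1Shape r`       — stub S1 of the line: upward equi-quasi-monotonicity in the noise (long chains, small rates).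
* `S2Shape r`       — stub S2 of the line: pointwise-in-`ε`, eventual-in-`N` closeness `r N ε ≤ r N 0 + η`.
* `M2Shape r`       — the exact small-noise SIGN of the live line v7 (`stub_smallNoiseReducesResponseEventually`,
                      resistivity form): `r N 0 ≤ r N ε` on a tail of lengths for small rates.

Results (sorry-free):
* `tableA_S1`, `tableA_not_uniform`      — S1 alone is NOT the crux (`r N ε = 1 + min 1 (Nε)`).
* `tableB_S2`, `tableB_not_uniform`      — S2 alone is NOT the crux (`r N ε = 2` on `Nε ∈ [1,2)`, else `1`).
* `tableE_uniform`, `tableE_S1`, `tableE_S2`, `tableE_not_M2` — the smooth noise-ENHANCEMENT table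
  `r N ε = 1/(1+ε)` (conductivities add: `D = 1 + ε`, the pattern of a localised bulk where flips open a hopping
  channel) satisfies the crux AND both stubs of the new line, but violates v7's exact sign M2⋆ at every length:
  the new line survives a regime that kills the live one.
-/

open Filter Topology

namespace Summit.AtomisticToContinuum.FouriersLaw.Cruxes.NoiseLocality.PolyaTables

/-- The crux in resistivity normal form. -/
def UniformShape (r : ℕ → ℝ → ℝ) : Prop :=
  ∃ w : ℝ → ℝ, Tendsto w (𝓝[>] 0) (𝓝 0) ∧ ∀ (N : ℕ) (ε : ℝ), 0 < ε → ε ≤ 1 → |r N ε - r N 0| ≤ w ε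

/-- Stub S1 (shape). -/
def S1Shape (r : ℕ → ℝ → ℝ) : Prop :=
  ∀ η : ℝ, 0 < η → ∃ (Nη : ℕ) (εη : ℝ), 0 < εη ∧ εη ≤ 1 ∧
    ∀ N : ℕ, Nη ≤ N → ∀ ε ε' : ℝ, 0 < ε → ε ≤ ε' → ε' ≤ εη → r N ε ≤ r N ε' + η

/-- Stub S2 (shape). -/
def S2Shape (r : ℕ → ℝ → ℝ) : Prop :=
  ∀ η : ℝ, 0 < η → ∃ εη : ℝ, 0 < εη ∧ εη ≤ 1 ∧
    ∀ ε : ℝ, 0 < ε → ε ≤ εη → ∃ N₀ : ℕ, ∀ N : ℕ, N₀ ≤ N → r N ε ≤ r N 0 + η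

/-- v7's exact small-noise sign M2⋆ (shape, resistivity form). -/
def M2Shape (r : ℕ → ℝ → ℝ) : Prop :=
  ∃ (Ns : ℕ) (εs : ℝ), 0 < εs ∧ ∀ N : ℕ, Ns ≤ N → ∀ ε : ℝ, 0 < ε → ε ≤ εs → r N 0 ≤ r N ε

/-! ## Table A: monotone in the noise, no uniform modulus -/

/-- `r N ε = 1 + min 1 (N ε)`: nondecreasing in `ε`, `r N 0 = 1`, `r N ε = 2` once `N ε ≥ 1`. -/
def tableA : ℕ → ℝ → ℝ := fun N ε => 1 + min 1 ((N : ℝ) * ε)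

theorem tableA_S1 : S1Shape tableA := by
  intro η hη
  refine ⟨0, 1, one_pos, le_rfl, fun N _ ε ε' hε hεε' _ => ?_⟩
  have hmono : min 1 ((N : ℝ) * ε) ≤ min 1 ((N : ℝ) * ε') :=
    min_le_min le_rfl (mul_le_mul_of_nonneg_left hεε' (Nat.cast_nonneg N))
  simp only [tableA]
  linarith

theorem tableA_not_uniform : ¬ UniformShape tableA := by
  rintro ⟨w, hw, h⟩
  have h1 : ∀ᶠ ε in 𝓝[>] (0 : ℝ), |w ε| < 1 / 2 := by
    have := (Metric.tendsto_nhds.mp hw) (1 / 2) (by norm_num)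
    simpa only [Real.dist_eq, sub_zero] using this
  have h2 : ∀ᶠ ε in 𝓝[>] (0 : ℝ), ε ≤ 1 := mem_nhdsWithin_of_mem_nhds (Iic_mem_nhds one_pos)
  have h3 : ∀ᶠ ε in 𝓝[>] (0 : ℝ), 0 < ε := self_mem_nhdsWithin
  obtain ⟨ε, hwε, hε1, hε⟩ := (h1.and (h2.and h3)).exists
  set N : ℕ := ⌈ε⁻¹⌉₊ with hN
  have hNε : 1 ≤ (N : ℝ) * ε := by
    have : ε⁻¹ ≤ (N : ℝ) := Nat.le_ceil _
    calc (1 : ℝ) = ε⁻¹ * ε := by field_simp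
      _ ≤ (N : ℝ) * ε := by gcongr
  have hval : tableA N ε - tableA N 0 = 1 := by
    simp only [tableA, mul_zero]
    rw [min_eq_left hNε, min_eq_right (zero_le_one)]
    ring
  have := h N ε hε hε1
  rw [hval, abs_one] at this
  have : (1 : ℝ) ≤ |w ε| := this.trans (le_abs_self _)
  linarith

/-! ## Table B: pointwise (eventual) closeness, no uniform modulus -/

/-- `r N ε = 2` when `N ε ∈ [1, 2)`, else `1` (a bump travelling to `N = ∞` as `ε ↓ 0`). -/
noncomputable def tableB : ℕ → ℝ → ℝ := fun N ε => if 1 ≤ (N : ℝ) * ε ∧ (N : ℝ) * ε < 2 then 2 else 1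

theorem tableB_zero (N : ℕ) : tableB N 0 = 1 := by
  simp [tableB]

theorem tableB_S2 : S2Shape tableB := by
  intro η hη
  refine ⟨1, one_pos, le_rfl, fun ε hε _ => ⟨⌈2 / ε⌉₊, fun N hN => ?_⟩⟩
  have hNε : 2 ≤ (N : ℝ) * ε := by
    have h1 : 2 / ε ≤ (N : ℝ) := (Nat.le_ceil _).trans (by exact_mod_cast hN)
    calc (2 : ℝ) = 2 / ε * ε := by field_simp
      _ ≤ (N : ℝ) * ε := by gcongr
  have hval : tableB N ε = 1 := by
    simp only [tableB]
    rw [if_neg]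
    push Not
    intro _
    exact hNε
  rw [hval, tableB_zero]
  linarith

theorem tableB_not_uniform : ¬ UniformShape tableB := by
  rintro ⟨w, hw, h⟩
  have h1 : ∀ᶠ ε in 𝓝[>] (0 : ℝ), |w ε| < 1 / 2 := by
    have := (Metric.tendsto_nhds.mp hw) (1 / 2) (by norm_num)
    simpa only [Real.dist_eq, sub_zero] using this
  have h2 : ∀ᶠ ε in 𝓝[>] (0 : ℝ), ε ≤ 1 / 2 := mem_nhdsWithin_of_mem_nhds (Iic_mem_nhds (by norm_num))
  have h3 : ∀ᶠ ε in 𝓝[>] (0 : ℝ), 0 < ε := self_mem_nhdsWithin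
  obtain ⟨ε, hwε, hε1, hε⟩ := (h1.and (h2.and h3)).exists
  set N : ℕ := ⌈ε⁻¹⌉₊ with hN
  have hlo : 1 ≤ (N : ℝ) * ε := by
    have : ε⁻¹ ≤ (N : ℝ) := Nat.le_ceil _
    calc (1 : ℝ) = ε⁻¹ * ε := by field_simp
      _ ≤ (N : ℝ) * ε := by gcongr
  have hhi : (N : ℝ) * ε < 2 := by
    have : (N : ℝ) < ε⁻¹ + 1 := Nat.ceil_lt_add_one (by positivity)
    calc (N : ℝ) * ε < (ε⁻¹ + 1) * ε := by gcongr
      _ = 1 + ε := by field_simp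
      _ < 2 := by linarith
  have hval : tableB N ε - tableB N 0 = 1 := by
    rw [tableB_zero]
    simp only [tableB]
    rw [if_pos ⟨hlo, hhi⟩]
    ring
  have := h N ε hε (by linarith)
  rw [hval, abs_one] at this
  have : (1 : ℝ) ≤ |w ε| := this.trans (le_abs_self _)
  linarith

/-! ## Table E: smooth noise-ENHANCED conduction — crux ✓, S1 ✓, S2 ✓, exact sign M2⋆ ✗ -/

/-- `r N ε = 1/(1+ε)` (`D = 1 + ε`: conductivities add), independent of `N`. -/
noncomputable def tableE : ℕ → ℝ → ℝ := fun _ ε => (1 + ε)⁻¹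

theorem tableE_sub {ε : ℝ} (hε : 0 ≤ ε) (N : ℕ) : tableE N 0 - tableE N ε = ε / (1 + ε) := by
  simp only [tableE, add_zero, inv_one]
  have : (1 + ε) ≠ 0 := by positivity
  field_simp
  ring

theorem tableE_uniform : UniformShape tableE := by
  refine ⟨id, tendsto_nhdsWithin_of_tendsto_nhds tendsto_id, fun N ε hε _ => ?_⟩
  rw [abs_sub_comm, tableE_sub hε.le N]
  simp only [id]
  rw [abs_of_nonneg (by positivity), div_le_iff₀ (by positivity)]
  nlinarith

theorem tableE_S1 : S1Shape tableE := by
  intro η hη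
  refine ⟨0, min 1 η, lt_min one_pos hη, min_le_left _ _, fun N _ ε ε' hε hεε' hε'η => ?_⟩
  have hε' : 0 < ε' := hε.trans_le hεε'
  have h1 : tableE N ε - tableE N ε' = (ε' - ε) / ((1 + ε) * (1 + ε')) := by
    simp only [tableE]
    have : (1 + ε) ≠ 0 := by positivity
    have : (1 + ε') ≠ 0 := by positivity
    field_simp
    ring
  have h2 : (ε' - ε) / ((1 + ε) * (1 + ε')) ≤ ε' := by
    rw [div_le_iff₀ (by positivity)]
    nlinarith [mul_pos hε hε']
  have h3 : ε' ≤ η := hε'η.trans (min_le_right _ _)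
  linarith

theorem tableE_S2 : S2Shape tableE := by
  intro η hη
  refine ⟨1, one_pos, le_rfl, fun ε hε _ => ⟨0, fun N _ => ?_⟩⟩
  have := tableE_sub hε.le N
  have h : 0 ≤ ε / (1 + ε) := by positivity
  linarith

theorem tableE_not_M2 : ¬ M2Shape tableE := by
  rintro ⟨Ns, εs, hεs, h⟩
  have := h Ns le_rfl εs hεs le_rfl
  have h2 := tableE_sub hεs.le Ns
  have h3 : 0 < εs / (1 + εs) := by positivity
  linarith

end Summit.AtomisticToContinuum.FouriersLaw.Cruxes.NoiseLocality.PolyaTables
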